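import Literature.AlgebraicGeometry.Resolution.Kuhlmann2019HenselianRationalitySteps
import Literature.AlgebraicGeometry.Resolution.HenselizationDefectless
import HarnessLib

/-!
# Kuhlmann 2010, Thm. 2.14, the "separably defectless" clause — discharge of `Kuhlmann2010SeparablyDefectlessIffHenselization`

Topic: `Literature/AlgebraicGeometry/Resolution` (valued function fields). PROVED companion of
`Kuhlmann2019HenselianRationalitySteps.lean`: its named fact
`Kuhlmann2010SeparablyDefectlessIffHenselization` = F.-V. Kuhlmann, *Elimination of
ramification I: The generalized stability theorem*, Trans. AMS 362 (2010) = arXiv:1003.5678,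
**Thm. 2.14**, the clause

> The same holds for "separably defectless" … in the place of "defectless". *Proof.* For
> "separably defectless", our assertion follows directly from [En], Theorem (18.2).

(`(K, v)` is separably defectless iff its henselization is; "separably defectless" = defectless
in every finite SEPARABLE extension, §1 p. 3, `IsSeparablyDefectlessField`). The proof is the one
of the "defectless" clause in `HenselizationDefectless.lean` (the classical argument behind [En]
(18.2): the degree formula `∑ᵢ [K^h(ιᵢL) : K^h] = [L : K]`, `e f` preserved along
`L ≅ ιᵢ(L) ⊆ K^h(ιᵢL) ⊆ ιᵢ(L)^h`, uniqueness of the extension over the henselian `K^h`), with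
separability threaded through:

* `⇐` (`isDefectlessIn_of_isSeparablyDefectlessField_henselization`): for `L|K` finite
  separable, each compositum `Mᵢ = K^h(ιᵢ(L))` is generated over `K^h` by elements separable
  over `K`, hence is separable over `K^h`, so the separable defectlessness of `K^h` applies to it.
* `⇒` (in `Kuhlmann2010SeparablyDefectlessIffHenselization_holds`): for `L'|K^h` finite
  separable, `L'|K` is separable because `K^h|K` is (`isSeparable_henselization`, Lemma 2.2:
  "separable-algebraic"), so the finite subextension `L = K(basis of L') ⊆ L'` is separable over
  `K` and `K` is defectless in it; the rest is verbatim.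

## Sources

* F.-V. Kuhlmann, Trans. AMS 362 (2010) = arXiv:1003.5678: §1 (p. 3), Lemma 2.2, Thm. 2.14.
* O. Endler, *Valuation theory* (1972), Thm. (18.2) — the source's reference.
-/

noncomputable section

open IsLocalRing

namespace Literature.AlgebraicGeometry.Resolution

universe u

section Main

variable {Ω : Type u} [Field Ω] [IsAlgClosed Ω] (V : ValuationSubring Ω) (K : Subfield Ω)
variable {L : Type u} [Field L] [Algebra K L] [FiniteDimensional K L]

omit [IsAlgClosed Ω] [FiniteDimensional K L] in
/-- `K^h(ι(L))` is separable over `K^h` when `L|K` is separable: it is generated by the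
images `ι(bⱼ)` of a basis, separable over `K ⊆ K^h`. [folklore] -/
theorem isSeparable_adjoin_henselization_of_isSeparable [Algebra.IsSeparable K L] {n : ℕ}
    (b : Module.Basis (Fin n) K L) (ι : L →ₐ[K] Ω) :
    Algebra.IsSeparable (henselization V K)
      (IntermediateField.adjoin (henselization V K) (Set.range (ι ∘ b))) := by
  refine (IntermediateField.isSeparable_adjoin_iff_isSeparable (henselization V K) Ω).mpr ?_
  rintro _ ⟨j, rfl⟩
  have h1 : IsSeparable K (ι (b j)) :=
    (isSeparable_map_iff ι (RingHom.injective _)).mpr (Algebra.IsSeparable.isSeparable K (b j))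
  exact IsSeparable.tower_top (henselization V K) h1

/-- **Kuhlmann 2010, Thm. 2.14 (separable clause), `⇐`**: if `K^h` is a separably defectless
field then `V ∩ K` is defectless in every finite separable extension `L` of `K`:
`∑ e f = ∑ e(V ∩ M_{O'} | K^h) f(V ∩ M_{O'} | K^h) = ∑ [M_{O'} : K^h] = [L : K]`, the composita
`M_{O'} = K^h(ι_{O'}(L))` being separable over `K^h`. PROVED. [cite: Kuhlmann2010, Thm. 2.14] -/
theorem isDefectlessIn_of_isSeparablyDefectlessField_henselization [Algebra.IsSeparable K L]
    (hdef : IsSeparablyDefectlessField (henselization V K)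
      (V.comap (algebraMap (henselization V K) Ω))) :
    IsDefectlessIn K (V.comap (algebraMap K Ω)) L := by
  classical
  have hC := Kuhlmann2010HenselizationImmediate_holds.{u}
  obtain ⟨s, hs, -⟩ := FundamentalInequality_holds K L inferInstance (V.comap (algebraMap K Ω))
  have hrep : ∀ O' : ValuationSubring L, ∃ ι : L →ₐ[K] Ω,
      O' ∈ s → V.comap ι.toRingHom = O' := by
    intro O'
    by_cases hO' : O' ∈ s
    · obtain ⟨ι, hι⟩ := exists_algHom_comap_eq V K O' ((hs O').mp hO')
      exact ⟨ι, fun _ => hι⟩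
    · haveI : IsAlgClosed (algebraicClosure K Ω) := IsAlgClosure.isAlgClosed K
      exact ⟨IsAlgClosed.lift, fun h => (hO' h).elim⟩
  choose rep hrep using hrep
  refine ⟨s, hs, ?_⟩
  rw [← sum_finrank_adjoin_eq_finrank V K (Module.finBasis K L) s hs rep hrep]
  refine Finset.sum_congr rfl fun O' hO' => ?_
  haveI := finiteDimensional_adjoin_henselization V K (Module.finBasis K L) (rep O')
  haveI := isSeparable_adjoin_henselization_of_isSeparable V K (Module.finBasis K L) (rep O')
  conv_lhs => rw [← hrep O' hO']
  rw [ramificationIndex_mul_inertiaDegree_comap_eq V K hC (rep O') _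
    (algHom_apply_mem_adjoin V K (Module.finBasis K L) (rep O'))
    (adjoin_toSubfield_le_henselization V K (Module.finBasis K L) (rep O'))]
  exact (isDefectlessIn_henselization_iff V K _).mp (hdef _ inferInstance inferInstance)

end Main

/-- **Kuhlmann 2010, Thm. 2.14, the "separably defectless" clause** — discharge of the named
fact `Kuhlmann2010SeparablyDefectlessIffHenselization`
(`Kuhlmann2019HenselianRationalitySteps.lean`): "Take a valued field `(K,v)` and fix an
extension of `v` to `K̃`. Then `(K,v)` is defectless if and only if its henselization `(K,v)^h`
in `(K̃,v)` is defectless. The same holds for 'separably defectless' … in the place of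
'defectless'." PROVED: `⇐` is `isDefectlessIn_of_isSeparablyDefectlessField_henselization`;
`⇒`: a finite separable extension `L'` of `K^h` is separable over `K` (`K^h|K` separable,
Lemma 2.2), so `L = K(basis of L') ⊆ L'` is a finite separable extension of `K`, in which `K`
is defectless; `isDefectlessIn_adjoin_of_isDefectlessIn` and the `K^h`-isomorphism
`L' ≅ K^h(ι(L))` (`IsDefectlessIn.congr`) conclude as in the defectless clause.
[cite: Kuhlmann2010, Thm. 2.14] -/
theorem Kuhlmann2010SeparablyDefectlessIffHenselization_holds :
    Kuhlmann2010SeparablyDefectlessIffHenselization.{u} := by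
  intro Ω _ _ V K
  have hC := Kuhlmann2010HenselizationImmediate_holds.{u}
  constructor
  · intro hdef L' _ _ hfin hsepL'
    haveI := hfin
    haveI := hsepL'
    -- `L'` as an extension of `K`, separable; the finite separable subextension `L = K(basis)`
    letI : Algebra K L' := ((algebraMap (henselization V K) L').comp
      (algebraMap K (henselization V K))).toAlgebra
    haveI : IsScalarTower K (henselization V K) L' := IsScalarTower.of_algebraMap_eq fun _ => rfl
    haveI := isAlgebraic_henselization V K
    haveI := isSeparable_henselization V K
    haveI : Algebra.IsAlgebraic K L' := Algebra.IsAlgebraic.trans K (henselization V K) L'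
    haveI : Algebra.IsSeparable K L' := Algebra.IsSeparable.trans K (henselization V K) L'
    let b' := Module.finBasis (henselization V K) L'
    let L : IntermediateField K L' := IntermediateField.adjoin K (Set.range b')
    haveI : FiniteDimensional K L := IntermediateField.finiteDimensional_adjoin fun x _ =>
      (Algebra.IsAlgebraic.isAlgebraic (R := K) x).isIntegral
    haveI : Algebra.IsSeparable K L := Algebra.isSeparable_tower_bot_of_isSeparable K L L'
    -- an embedding of `L'` into `Ω` over `K^h`, restricted to `L`
    let ι' : L' →ₐ[henselization V K] Ω := IsAlgClosed.lift
    let ι : L →ₐ[K] Ω := (ι'.restrictScalars K).comp (IsScalarTower.toAlgHom K L L')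
    have hιι' : ∀ x : L, ι x = ι' (x : L') := fun _ => rfl
    -- `ι'(L') = K^h(ι(L))`
    have hrange : ι'.fieldRange = IntermediateField.adjoin (henselization V K)
        (Set.range (ι ∘ Module.finBasis K L)) := by
      apply le_antisymm
      · intro x hx
        obtain ⟨z, rfl⟩ := AlgHom.mem_fieldRange.mp hx
        have hz : z = ∑ j, b'.repr z j • b' j := (b'.sum_repr z).symm
        rw [hz, map_sum]
        refine sum_mem fun j _ => ?_
        rw [map_smul, Algebra.smul_def]
        refine mul_mem (IntermediateField.algebraMap_mem _ _) ?_
        have hbj : b' j ∈ L := IntermediateField.subset_adjoin K _ ⟨j, rfl⟩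
        rw [show ι' (b' j) = ι ⟨b' j, hbj⟩ from rfl]
        exact algHom_apply_mem_adjoin V K (Module.finBasis K L) ι _
      · rw [IntermediateField.adjoin_le_iff]
        rintro _ ⟨i, rfl⟩
        exact AlgHom.mem_fieldRange.mpr ⟨_, (hιι' _).symm⟩
    let Θ : L' ≃ₐ[henselization V K] IntermediateField.adjoin (henselization V K)
        (Set.range (ι ∘ Module.finBasis K L)) :=
      (AlgEquiv.ofInjectiveField ι').trans (IntermediateField.equivOfEq hrange)
    have hL : IsDefectlessIn K (V.comap (algebraMap K Ω)) L := hdef L inferInstance inferInstance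
    have hM := isDefectlessIn_adjoin_of_isDefectlessIn V K hC hL ι
    refine IsDefectlessIn.congr (RingEquiv.refl (henselization V K)) Θ.symm.toRingEquiv
      (fun x => ?_) (by ext; rfl) hM
    change Θ.symm (algebraMap (henselization V K) _ x) = algebraMap (henselization V K) L' x
    exact Θ.symm.commutes x
  · intro hdef L _ _ hfin hsep
    haveI := hfin
    haveI := hsep
    exact isDefectlessIn_of_isSeparablyDefectlessField_henselization V K hdef

end Literature.AlgebraicGeometry.Resolution
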